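import Summits.NavierStokesRegularity.FluidComputer.ClayBlowupProfile
import Summits.NavierStokesRegularity.FluidComputer.ClayBlowupSingularSliceNull
import HarnessLib

/-!
# THE BLOW-UP PROFILE OF AN UNFORCED CLAY BLOW-UP HAS FINITE ENERGY: `u(t) → U` a.e. as `t ↑ T` and
# `∫ |U|² ≤ E` (Fatou through the energy bound)

Cell `ns-blowup`, seat `ns-blowup-ecbridge-2` (g8; the E–C endpoint theory seat). LABEL: E–C typing,
(A)-side (KERNEL — no named fact, no new definition). WHAT THIS IS NOT: not Navier–Stokes evidence — a
structural necessary condition on the UNFORCED inhabitants of `ClayBlowup ν`; no inhabitant is claimed.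
Companion memo: `run/shared/lean/pub/ns-blowup/ecbridge2/ECBRIDGE-2-MEMO-7.md`.

## Content

`ClayBlowupProfile.lean` (g8) gives the blow-up profile `U`, continuous on the regular set
`ℝ³ ∖ S_T`, with `u(t, x) → U(x)` as `t ↑ T` at every regular `x`. Since the singular slice `S_T` is
Lebesgue-null (`volume_singularSlice_eq_zero`, g6 — indeed `ℋ¹`-null, g7), the convergence holds
ALMOST EVERYWHERE, and Fatou's lemma along `t ↑ T` with the ONE energy bound of the type (`energy_le`)
gives `∫ |U|² ≤ E < ∞`:

* **`ClayBlowup.exists_blowupProfile_finiteEnergy`** — `∃ U`, continuous on the regular set, with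
  `u(t, x) → U(x)` for every regular `x` AND for a.e. `x`, and `∫⁻ ‖U‖ₑ² ≤ E` where `E < ∞` bounds
  `∫⁻ ‖u(t)‖ₑ²` on `[0, T)`.

So the final state of a ¬(A) witness is a finite-energy field, continuous off a compact `ℋ¹`-null set.

References: J. Leray, Acta Math. 63 (1934), §32 [cite: Leray1934, §32]; L. Escauriaza, G. Seregin,
V. Šverák, Russ. Math. Surveys 58 (2003), Thm. 1.4 [cite: EscauriazaSereginSverak2003, Thm. 1.4];
C. L. Fefferman, Clay problem description, (A), (7) [cite: FeffermanClay2006, (A)].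
-/

noncomputable section

namespace Summit.NavierStokesRegularity.FluidComputer

open Set MeasureTheory Filter Topology Function Metric TopologicalSpace
open scoped ENNReal NNReal
open Literature.Analysis.FluidPDE
open Summit.NavierStokesRegularity.NavierStokesRegularity

namespace ClayBlowup

variable {ν : ℝ} (X : ClayBlowup ν)

/-- **THE BLOW-UP PROFILE HAS FINITE ENERGY** (`ν > 0`, `f = 0`; no named fact): there is
`U : ℝ³ → ℝ³`, continuous on the regular set `{x | IsBackwardBoundedAt u T x}`, with
`u(t, x) → U(x)` as `t ↑ T` at every regular `x`, hence for a.e. `x` (the singular slice is null), and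
`∫⁻ ‖U‖ₑ² ≤ E` for the energy bound `E < ∞` of the type on `[0, T)` (Fatou along `t ↑ T`).
[cite: Leray1934, §32] [cite: EscauriazaSereginSverak2003, Thm. 1.4] -/
theorem exists_blowupProfile_finiteEnergy (hν : 0 < ν) (hf : X.f = 0) :
    ∃ U : EuclideanSpace ℝ (Fin 3) → EuclideanSpace ℝ (Fin 3),
      ContinuousOn U {x | IsBackwardBoundedAt X.u X.T x} ∧
      (∀ x : EuclideanSpace ℝ (Fin 3), IsBackwardBoundedAt X.u X.T x →
        Tendsto (fun t => X.u t x) (𝓝[<] X.T) (𝓝 (U x))) ∧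
      (∀ᵐ x : EuclideanSpace ℝ (Fin 3), Tendsto (fun t => X.u t x) (𝓝[<] X.T) (𝓝 (U x))) ∧
      ∃ E : ℝ≥0∞, E < ⊤ ∧ (∀ t ∈ Ico 0 X.T, ∫⁻ x, ‖X.u t x‖ₑ ^ 2 ≤ E) ∧
        ∫⁻ x, ‖U x‖ₑ ^ 2 ≤ E := by
  have hT := X.T_pos
  obtain ⟨U, hUc, hU⟩ := X.tendsto_slice_blowupProfile hν hf
  obtain ⟨E, hEt, hE⟩ := X.energy_le hν
  -- a.e. convergence: the singular slice is Lebesgue-null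
  have hae : ∀ᵐ x : EuclideanSpace ℝ (Fin 3), Tendsto (fun t => X.u t x) (𝓝[<] X.T) (𝓝 (U x)) := by
    have hnull := X.volume_singularSlice_eq_zero hν
    rw [ae_iff]
    refine measure_mono_null (fun x hx => ?_) hnull
    simp only [mem_setOf_eq] at hx ⊢
    exact fun hreg => hx (hU x hreg)
  refine ⟨U, hUc, hU, hae, E, hEt, hE, ?_⟩
  -- Fatou along `t ↑ T`, with the slices outside `[0, T)` replaced by `0` (measurability)
  classical
  set g : ℝ → EuclideanSpace ℝ (Fin 3) → ℝ≥0∞ := fun t x =>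
    if t ∈ Ico 0 X.T then ‖X.u t x‖ₑ ^ 2 else 0 with hg
  have hg_meas : ∀ t, AEMeasurable (g t) volume := by
    intro t
    by_cases ht : t ∈ Ico 0 X.T
    · have hcont : Continuous (X.u t) := (X.classical.contDiff_velocity ht).continuous
      have : g t = fun x => ‖X.u t x‖ₑ ^ 2 := by
        funext x; simp only [hg, if_pos ht]
      rw [this]
      exact ((ENNReal.continuous_pow 2).comp hcont.enorm).aemeasurable
    · have : g t = fun _ => 0 := by
        funext x; simp only [hg, if_neg ht]
      rw [this]
      exact aemeasurable_const
  have hev : ∀ᶠ t in 𝓝[<] X.T, t ∈ Ico 0 X.T := Ico_mem_nhdsLT hT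
  -- the liminf of the slices is `‖U x‖²` a.e.
  have hlim : ∀ᵐ x : EuclideanSpace ℝ (Fin 3),
      liminf (fun t => g t x) (𝓝[<] X.T) = ‖U x‖ₑ ^ 2 := by
    filter_upwards [hae] with x hx
    have h1 : Tendsto (fun t => ‖X.u t x‖ₑ ^ 2) (𝓝[<] X.T) (𝓝 (‖U x‖ₑ ^ 2)) :=
      ENNReal.Tendsto.pow hx.enorm
    have h2 : (fun t => g t x) =ᶠ[𝓝[<] X.T] fun t => ‖X.u t x‖ₑ ^ 2 := by
      filter_upwards [hev] with t ht
      simp only [hg, if_pos ht]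
    rw [liminf_congr h2]
    exact h1.liminf_eq
  calc ∫⁻ x, ‖U x‖ₑ ^ 2 = ∫⁻ x, liminf (fun t => g t x) (𝓝[<] X.T) :=
        lintegral_congr_ae (hlim.mono fun x hx => hx.symm)
    _ ≤ liminf (fun t => ∫⁻ x, g t x) (𝓝[<] X.T) := lintegral_liminf_le' hg_meas
    _ ≤ E := by
        refine liminf_le_of_frequently_le' (Eventually.frequently ?_)
        filter_upwards [hev] with t ht
        have : (fun x => g t x) = fun x => ‖X.u t x‖ₑ ^ 2 := by
          funext x; simp only [hg, if_pos ht]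
        rw [this]
        exact hE t ht

end ClayBlowup

end Summit.NavierStokesRegularity.FluidComputer

end
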